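import Literature.MathematicalPhysics.QuantumFieldTheory.Balaban1983to89.B1Eq331Model
import Literature.MathematicalPhysics.QuantumFieldTheory.Balaban1983to89.B1Ineq368QuadForms

/-!
# `Balaban1983to89.B1Eq369Model` — T. Bałaban, *(Higgs)₂,₃ quantum fields in a finite volume. I. A lower bound*,
Commun. Math. Phys. **85** (1982) 603–626 [Balaban1982Higgs1]: the last display **(3.69)** p. 625 — *"Z_KZ_K(0) exp(−E₀) = … ≧ exp[−½a_K(L^Kε)^{d−2}
(Tr P_KG^ε + Tr P_KG^ε(0)) + O(1)|T_ε|] = exp(O(1)|T_ε|)"* — PROVED FOR THE CONCRETE (Higgs)₂,₃ MODEL: the model's own `Z_K` (3.31), `Z_K(0)` (3.32)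
and `E₀` (1.12) (file 1 `B1Eq331Model`) satisfy `exp(−C₆|T_ε|) ≦ Z_KZ_K(0)e^{−E₀}` with an EXPLICIT `C₆` that is INDEPENDENT of `ε` under the
stopping rule of p. 624, whence the field `h369` of the model's ledger of (1.14) (`B1LowerBound114Model.Inputs`) is DISCHARGED

statement-level skeleton of published theorems with citation tags; proofs where landed; nothing here is a claim about the Yang–Mills mass gap

PDF held: `paper:balaban1982-cmp85-higgs23-i` (journal page = PDF page + 602); p. 625 [PDF 23] ((3.68)–(3.69)) and p. 624 [PDF 22] ((3.66), the
stopping rule) READ AS IMAGES on the ×2 renders `run/shared/lean/pub/pub-balaban/b2b-balaban-ref1/pages/1982-cmp85-higgs23-I/…-p023-x2.png`,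
`…-p022-x2.png`; p. 617 [PDF 15] ((3.31)–(3.32)), p. 606 [PDF 4] ((1.12)), p. 609 [PDF 7] ((2.15)).

CITATION HEADER (lean-in-tree rule).  Cell `lit-balaban` (HOME `run/shared/lean/pub/lit-balaban/`), Phase-2 proof seat **p14** gen 11 (unit
`lit-balaban-p14`; TAKING line HOME/STATUS.md 2026-08-21T20:41Z), file 2 of 2.  SKELETON rows **B1.Eq3.68–3.69** (owner r12: typed `B1Sect3Statements.Ineq368`/
`Ineq369`, (3.69) proved at the matrix carriers by p12 `B1Eq369GaussRatio` with the operators as ARGUMENTS and the trace/volume inputs displayed)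
and **B1.Thm@606** (model ledger).  THIS FILE instantiates p12's determinant calculus AT THE MODEL: `gaussInt_add_eq`, `ineq369_mul_inv`,
`trace_mul_le_of_le`, `trace_adj_mul_eq_card`, `posSemidef_inv_smul_one_sub_inv`, `det_one_add_mul_inv_pos` are used BY NAME on file 1's matrices, whose
hypotheses file 1 proved (`posDef_mat_delta0`, `posSemidef_mat_delta0_sub`, `posSemidef_smul_QksQk`, `mat_Qk_mul_mat_Qks`); the ledger side uses this
seat's `B1Ineq368QuadForms.PreInputs.toInputs` (gen 11) and `B1LowerBound114Model` (gen 7).  Nothing of record is restated.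

WHAT IS PRINTED (verbatim, p. 625 [PDF 23]).  *"We get Z^ε ≧ Z_KZ_K(0)exp(−E₀ + O(1)|T_ε|). (3.68) It is easily seen that Z_KZ_K(0) is almost equal exp(E₀),
more exactly we have Z_KZ_K(0) exp(−E₀) = [det(I + a_K(L^Kε)^{d−2}P_KG^ε)]^{−1/2}·[det(I + a_K(L^Kε)^{d−2}P_KG^ε(0))]^{−1/2} exp(O(1)|T_ε|) ≧
exp[−½a_K(L^Kε)^{d−2}(Tr P_KG^ε + Tr P_KG^ε(0)) + O(1)|T_ε|] = exp(O(1)|T_ε|), (3.69) and we obtain finally the required lower bound."*; p. 625: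
*"a constant O(1) which in general depends on L^Kε, thus on ε₀"*; p. 624: *"We take K such that L^Kε ≦ ε₀, but L^{K+1}ε > ε₀"*.

THE ARGUMENT AT THE MODEL (p12's reading, made concrete).  With `G^ε = (−Δ^ε + μ₀²)⁻¹ = M₀⁻¹`, `(G^ε_K)⁻¹ = M₀ + R`, `R = a_K(L^Kε)^{−2}Q_K^*Q_K ⪰ 0`
((2.20) in file 1's coordinates), the Gaussian ratio is a determinant ratio: `Z_KZ_K(0)e^{−E₀} = q^{(d/2)n}q^{(N/2)n}·det(I + RM₀⁻¹)^{−1/2}det(I + R′M₀′⁻¹)^{−1/2}`,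
`q = a_K(L^Kε)^{d−2}/2π`, `n = |T^{(K)}|` (`eq369_model`); `det(I + RM₀⁻¹)^{−1/2} ≧ exp(−½Tr RM₀⁻¹)` (p12/r12 `ineq369_mul_inv`); `Tr RM₀⁻¹ ≦ μ₀⁻²Tr R`
(`M₀ ≽ μ₀²`) and `Tr R = a_K(L^Kε)^{−2}·Tr Q_K^*Q_K = a_K(L^Kε)^{−2}·d·n` (`Q_KQ_K^* = 1`); so `log(Z_KZ_K(0)e^{−E₀}) ≧ ½(d+N)n·log q −
½a_K(L^Kε)^{−2}(μ₀⁻²d + m⁻²N)n` (`ineq369_model`).  Since `n = (L^Kε)^{−d}|T_ε|` ((1.21)), `a(1−L⁻²) < a_K ≦ a` ((2.15)) and `ε₀/L < L^Kε ≦ ε₀ ≦ 1`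
(p. 624), this is `≧ −C₆|T_ε|` with the ε-INDEPENDENT `C₆ = (L/ε₀)^d[½(d+N)(|log(a(1−L⁻²))| + |d−2|log(L/ε₀) + log 2π) + ½a(L/ε₀)²(μ₀⁻²d + m⁻²N)]`
(`c6Unif`, `ineq369_model_unif`) — *"thus on ε₀"*.

WHAT THIS FILE PROVES (kernel-checked, zero `sorry`; axioms standard).
* §1 `M0`, `Rk` (abbreviations for file 1's matrices), `gaussInt_covOpK_eq` (the Gaussian ratio is a determinant ratio), **`eq369_model`** ((3.69) FIRST EQUALITY
  for the model, exact), `trace_Rk_mul_inv_le` (`Tr RM₀⁻¹ ≦ m⁻²·a_K(L^Kε)^{−2}·N·|T^{(K)}|`), **`ineq369_model`** ((3.69) INEQUALITY for the model with the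
  explicit exponent `½(d+N)|T^{(K)}|log q − ½a_K(L^Kε)^{−2}(μ₀⁻²d + m⁻²N)|T^{(K)}|`).
* §2 `card_site_eq_vol` (`|T^{(K)}| = (L^Kε)^{−d}|T_ε|`), `log_prec_ge` (`log q ≧ −(|log(a(1−L⁻²))| + |d−2|log(L/ε₀) + log 2π)` under the stopping rule),
  the ε-independent `c6Unif d N L a μ₀² m² ε₀` and **`ineq369_model_unif`**: `exp(−c6Unif·|T_ε|) ≦ Z_KZ_K(0)e^{−E₀}` for every `1 ≦ K ≦` the `K` of (1.2)
  with `L^Kε ≦ ε₀ ≦ 1`, `ε₀ < L^{K+1}ε` — the print's *"= exp(O(1)|T_ε|)"* with `O(1)` depending on `ε₀` only.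
* §3 the ledger: `PreInputs369 D U P` = this seat's `B1Ineq368QuadForms.PreInputs` WITHOUT the normalisation data (`ZK, ZK0, E₀, hZK, hZK0, h369`), the
  expansion input (E1) of Prop. 3.1 now stated for the model's OWN `Z_K = zVec`, `Z_K(0) = zScal`, `E₀ = ModelData.e0` (and the concrete forms of gen 11),
  at a stopping scale `K ≧ 1`; **`PreInputs369.toPreInputs`** (given `c6Unif ≦ C₆`, `ε₀ ≦ 1`), `toInputs`, **`lowerBound_lattice_of_preInputs369`**
  (`exp(−E₋|T_ε|) ≦ Z^ε` per lattice, `E₋ = U.eMinus D`); the sub-family of the lattices that admit a stopping scale `1 ≦ K ≦ K_{(1.2)}` (`HasStop`,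
  `cutoffFamilyStop`) and **`lowerBoundWith_cutoffFamilyStop`** / `lowerBoundPrinted_cutoffFamilyStop`: the lower half of (1.14) on it with ONE constant.
HONEST SCOPE.  (3.69) is proved here for the model's ACTUAL normalisations; the remaining displayed inputs of the ledger are exactly the deep ones: the
(3.26) step bound `h360` (Props. 3.1/3.2, (3.38)–(3.60)), (E1) Prop. 3.1 at `k = K` (for the concrete `Z_K, Z_K(0), E₀` and forms), (E2) `|V^{(K),ε}| ≦
C₂|T_ε|` (Prop. 3.2), (E3) `χ_K = 1` on `S_{r₀}` (discharged at zero field on the torus sub-family modulo the scalar propagator bound, gen 10).  `K ≧ 1`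
(for `K = 0` no step is performed and (3.31)–(3.32) do not occur; the tree's `a_0 = 0` would make `Z_0 = 0`); `ε₀ ≦ 1` (the print's small `ε₀`);
`m², μ₀² > 0` (p. 605).  READING NOTE (lattices with `ε > ε₀`): the print's stopping rule presupposes `ε ≦ ε₀` (`B1StoppingScale366`: no `K` exists otherwise),
so the family-level assembly is stated on the sub-family `HasStop`; r01's full `cutoffFamily` (every `ε > 0`) is not claimed.  Nothing here is summit progress.
-/

open scoped BigOperators InnerProductSpace Matrix
open _root_.MeasureTheory Matrix

namespace Literature.MathematicalPhysics.QuantumFieldTheory.Balaban1983to89.B1Eq369Model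

open HiggsLattice HiggsCovariance HiggsCovariancePos B3MultiscaleFields B1Eq221Coordinates B1Eq230FluctCov B1GaussNorm339 B1Eq331Model
  B1Ineq368BoxBound B1LowerBound114Model B1Sect1Statements B1Ineq368QuadForms
open HiggsFluctMeasure (coeff221 coeff221_eq)
open HiggsFluctMeasurePos (coeff221_pos)
open HiggsDoubleRT (doubleRTk)
open B1Ineq326HiggsModel (chiW extW)
open B1Eq369GaussRatio (gaussInt_add_eq ineq369_mul_inv trace_mul_le_of_le trace_adj_mul_eq_card posSemidef_inv_smul_one_sub_inv
  det_one_add_mul_inv_pos gaussInt_pos)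

variable {P : HiggsLattice.Params} {N : ℕ}

/-! ## §1 (3.69) for the model: the Gaussian ratio is a determinant ratio; the det–trace inequality; the trace -/

section Det

variable (C : ChargeData N) (msq a : ℝ)

/-- `M₀ = mat(−Δ^{ε,N}_0 + m²)`: the coordinate matrix of the FREE operator of (1.12)/(2.17) (`G^ε(0) = M₀⁻¹`; the vector one is the case
`C = zeroCharge d`, mass `μ₀²`). [cite: Balaban1982Higgs1, (1.12) p.606; (2.17) p.610] -/
noncomputable abbrev M0 (C : ChargeData N) (msq : ℝ) : Matrix (HiggsLattice.Site P 0 × Ix N) (HiggsLattice.Site P 0 × Ix N) ℝ :=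
  mat (delta0 C Finset.univ (0 : HiggsLattice.VecField P 0) msq)

/-- `R = a_K(L^Kε)^{−2}·(mat Q^*_K)(mat Q_K)`: the coordinate matrix of the block term of (2.20) at `A = 0` — the print's `a_K(L^Kε)^{…}P_K`.
[cite: Balaban1982Higgs1, (2.20) p.610; (3.69) p.625] -/
noncomputable abbrev Rk (C : ChargeData N) (a : ℝ) (K : ℕ) : Matrix (HiggsLattice.Site P 0 × Ix N) (HiggsLattice.Site P 0 × Ix N) ℝ :=
  coeff221 P a K • (mat (avgQkAdj C (0 : HiggsLattice.VecField P 0) K) * mat (avgQkLin C (0 : HiggsLattice.VecField P 0) K))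

/-- **A Gaussian ratio is a determinant ratio, at the model**: `∫dφ e^{−½⟨φ,(G^ε_K(0))⁻¹φ⟩} = ∫dφ e^{−½⟨φ,(−Δ+m²)φ⟩}·det(I + RM₀⁻¹)^{−1/2}` (p12's
`gaussInt_add_eq` with file 1's `M₀ ≻ 0`, `R ⪰ 0`; `k ≧ 1`, `m² > 0`, `a > 0`, `L > 1`). [cite: Balaban1982Higgs1, (3.69) p.625] -/
theorem gaussInt_covOpK_eq (hmsq : 0 < msq) (ha : 0 < a) (hL : 1 < (P.L : ℝ)) {K : ℕ} (hK1 : 1 ≤ K) :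
    gaussInt (P.mesh 0) P.d (mat (covOpK C Finset.univ (0 : HiggsLattice.VecField P 0) msq a K))
      = gaussInt (P.mesh 0) P.d (M0 (P := P) C msq) * (1 + Rk C a K * (M0 (P := P) C msq)⁻¹).det ^ (-(1 / 2 : ℝ)) := by
  rw [mat_covOpK]
  exact gaussInt_add_eq (P.mesh_pos 0) P.d (posDef_mat_delta0 C Finset.univ 0 msq hmsq)
    (posSemidef_smul_QksQk C 0 K (coeff221_pos ha hL hK1).le)

/-- **(3.69), FIRST EQUALITY, FOR THE MODEL (exact)**: `Z_KZ_K(0)e^{−E₀} = q^{(d/2)|T^{(K)}|}·q^{(N/2)|T^{(K)}|}·det(I + R_vM₀,v⁻¹)^{−1/2}·det(I + R_sM₀,s⁻¹)^{−1/2}`,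
`q = a_K(L^Kε)^{d−2}/2π` — the print's `[det(I + a_K(L^Kε)^{…}P_KG^ε)]^{−1/2}[det(…G^ε(0))]^{−1/2}exp(O(1)|T_ε|)` with the `O(1)|T_ε|` being exactly the
logarithm of the (3.31)–(3.32) prefactors. [cite: Balaban1982Higgs1, (3.69) p.625; (3.31)–(3.32) p.617; (1.12) p.606] -/
theorem eq369_model {msq mu0sq a : ℝ} (hmsq : 0 < msq) (hmu : 0 < mu0sq) (ha : 0 < a) (hL : 1 < (P.L : ℝ)) {K : ℕ} (hK1 : 1 ≤ K) :
    zVec P mu0sq a K * zScal P C msq a K * Real.exp (-freeNormalization P 0 N C msq mu0sq)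
      = (B1RT.prec (B1.aSeq a P.L K) (P.mesh K) P.d / (2 * Real.pi)) ^ ((P.d : ℝ) / 2 * (Fintype.card (HiggsLattice.Site P K) : ℝ))
        * (B1RT.prec (B1.aSeq a P.L K) (P.mesh K) P.d / (2 * Real.pi)) ^ ((N : ℝ) / 2 * (Fintype.card (HiggsLattice.Site P K) : ℝ))
        * ((1 + Rk (zeroCharge P.d) a K * (M0 (P := P) (zeroCharge P.d) mu0sq)⁻¹).det ^ (-(1 / 2 : ℝ))
          * (1 + Rk C a K * (M0 (P := P) C msq)⁻¹).det ^ (-(1 / 2 : ℝ))) := by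
  have hV : 0 < gaussInt (P.mesh 0) P.d (M0 (P := P) (zeroCharge P.d) mu0sq) :=
    gaussInt_pos (P.mesh_pos 0) P.d (posDef_mat_delta0 (zeroCharge P.d) Finset.univ (0 : HiggsLattice.VecField P 0) mu0sq hmu)
  have hS : 0 < gaussInt (P.mesh 0) P.d (M0 (P := P) C msq) :=
    gaussInt_pos (P.mesh_pos 0) P.d (posDef_mat_delta0 C Finset.univ (0 : HiggsLattice.VecField P 0) msq hmsq)
  rw [Real.exp_neg, exp_freeNormalization_eq_gaussInt C hmsq hmu, zVec, zScal, gaussV_eq_gaussInt, gaussS_eq_gaussInt,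
    gaussInt_covOpK_eq (zeroCharge P.d) mu0sq a hmu ha hL hK1, gaussInt_covOpK_eq C msq a hmsq ha hL hK1, mul_inv]
  set gV := gaussInt (P.mesh 0) P.d (M0 (P := P) (zeroCharge P.d) mu0sq)
  set gS := gaussInt (P.mesh 0) P.d (M0 (P := P) C msq)
  set dv := (1 + Rk (zeroCharge P.d) a K * (M0 (P := P) (zeroCharge P.d) mu0sq)⁻¹).det ^ (-(1 / 2 : ℝ))
  set ds := (1 + Rk C a K * (M0 (P := P) C msq)⁻¹).det ^ (-(1 / 2 : ℝ))
  set qd := (B1RT.prec (B1.aSeq a P.L K) (P.mesh K) P.d / (2 * Real.pi)) ^ ((P.d : ℝ) / 2 * (Fintype.card (HiggsLattice.Site P K) : ℝ))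
  set qN := (B1RT.prec (B1.aSeq a P.L K) (P.mesh K) P.d / (2 * Real.pi)) ^ ((N : ℝ) / 2 * (Fintype.card (HiggsLattice.Site P K) : ℝ))
  linear_combination (qd * qN * dv * ds * (gS * gS⁻¹)) * mul_inv_cancel₀ hV.ne' + (qd * qN * dv * ds) * mul_inv_cancel₀ hS.ne'

/-- The internal index of one site of an `ℝ^N`-valued field has `N` elements (p34's coordinates are orthonormal). [cite: Balaban1982Higgs1, (1.5) p.604] -/
theorem card_Ix (N : ℕ) : Fintype.card (Ix N) = N := by
  rw [Fintype.card_fin]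
  exact finrank_euclideanSpace_fin

/-- **The trace input of (3.69) at the model**: `Tr RM₀⁻¹ ≦ m⁻²·a_K(L^Kε)^{−2}·N·|T^{(K)}|` — `M₀ ≽ m²` (file 1), `Tr Q^*_KQ_K = Tr Q_KQ^*_K = N|T^{(K)}|`
(`Q_KQ^*_K = 1`, `K ≦` the `K` of (1.2)). [cite: Balaban1982Higgs1, (3.69) p.625; (2.20) p.610] -/
theorem trace_Rk_mul_inv_le (hmsq : 0 < msq) (ha : 0 < a) (hL : 1 < (P.L : ℝ)) {K : ℕ} (hK1 : 1 ≤ K) (hK : K ≤ P.K) :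
    (Rk C a K * (M0 (P := P) C msq)⁻¹).trace ≤ msq⁻¹ * (coeff221 P a K * ((Fintype.card (HiggsLattice.Site P K) : ℝ) * N)) := by
  have hR := posSemidef_smul_QksQk C (0 : HiggsLattice.VecField P 0) K (coeff221_pos ha hL hK1).le
  have hG := posSemidef_inv_smul_one_sub_inv (posDef_mat_delta0 C Finset.univ (0 : HiggsLattice.VecField P 0) msq hmsq) hmsq
    (posSemidef_mat_delta0_sub C Finset.univ 0 msq)
  have h := trace_mul_le_of_le hR hG
  have htr : (coeff221 P a K • (mat (avgQkAdj C (0 : HiggsLattice.VecField P 0) K) * mat (avgQkLin C (0 : HiggsLattice.VecField P 0) K))).trace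
      = coeff221 P a K * ((Fintype.card (HiggsLattice.Site P K) : ℝ) * N) := by
    rw [trace_smul, smul_eq_mul, trace_adj_mul_eq_card _ _ (mat_Qk_mul_mat_Qks C 0 hK), Fintype.card_prod, card_Ix, Nat.cast_mul]
  rw [htr] at h
  exact h

/-- **(3.69), THE INEQUALITY, FOR THE MODEL**: `Z_KZ_K(0)e^{−E₀} ≧ exp[½(d+N)|T^{(K)}|·log q − ½a_K(L^Kε)^{−2}(μ₀⁻²d + m⁻²N)|T^{(K)}|]` — the print's
`≧ exp[−½a_K(L^Kε)^{…}(Tr P_KG^ε + Tr P_KG^ε(0)) + O(1)|T_ε|]` with every constant explicit (`1 ≦ K ≦` the `K` of (1.2)). [cite: Balaban1982Higgs1, (3.69) p.625] -/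
theorem ineq369_model {msq mu0sq a : ℝ} (hmsq : 0 < msq) (hmu : 0 < mu0sq) (ha : 0 < a) (hL : 1 < (P.L : ℝ)) {K : ℕ} (hK1 : 1 ≤ K)
    (hK : K ≤ P.K) :
    Real.exp (((P.d : ℝ) + N) / 2 * (Fintype.card (HiggsLattice.Site P K) : ℝ) * Real.log (B1RT.prec (B1.aSeq a P.L K) (P.mesh K) P.d / (2 * Real.pi))
        - (1 / 2) * coeff221 P a K * (mu0sq⁻¹ * P.d + msq⁻¹ * N) * (Fintype.card (HiggsLattice.Site P K) : ℝ))
      ≤ zVec P mu0sq a K * zScal P C msq a K * Real.exp (-freeNormalization P 0 N C msq mu0sq) := by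
  rw [eq369_model C hmsq hmu ha hL hK1]
  -- the two determinant factors dominate the trace exponentials (p12/r12 `ineq369_mul_inv`), traces bounded by file 1's matrix facts
  have hMv := posDef_mat_delta0 (zeroCharge P.d) Finset.univ (0 : HiggsLattice.VecField P 0) mu0sq hmu
  have hMs := posDef_mat_delta0 C Finset.univ (0 : HiggsLattice.VecField P 0) msq hmsq
  have hRv := posSemidef_smul_QksQk (zeroCharge P.d) (0 : HiggsLattice.VecField P 0) K (coeff221_pos ha hL hK1).le
  have hRs := posSemidef_smul_QksQk C (0 : HiggsLattice.VecField P 0) K (coeff221_pos ha hL hK1).le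
  have h1 := ineq369_mul_inv hMv hRv
  have h2 := ineq369_mul_inv hMs hRs
  unfold B1Sect3Statements.Ineq369 at h1 h2
  have t1 := trace_Rk_mul_inv_le (zeroCharge P.d) mu0sq a hmu ha hL hK1 hK
  have t2 := trace_Rk_mul_inv_le C msq a hmsq ha hL hK1 hK
  set q : ℝ := B1RT.prec (B1.aSeq a P.L K) (P.mesh K) P.d / (2 * Real.pi)
  set n : ℝ := (Fintype.card (HiggsLattice.Site P K) : ℝ)
  have hq : 0 < q := div_pos (B1RT.prec_pos (B1.aSeq_pos ha hL hK1) (P.mesh_pos K) P.d) (by positivity)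
  have hpref : q ^ ((P.d : ℝ) / 2 * n) * q ^ ((N : ℝ) / 2 * n) = Real.exp (((P.d : ℝ) + N) / 2 * n * Real.log q) := by
    rw [← Real.rpow_add hq, Real.rpow_def_of_pos hq]
    congr 1
    ring
  have hexp : Real.exp (((P.d : ℝ) + N) / 2 * n * Real.log q - (1 / 2) * coeff221 P a K * (mu0sq⁻¹ * P.d + msq⁻¹ * N) * n)
      = Real.exp (((P.d : ℝ) + N) / 2 * n * Real.log q)
        * (Real.exp (-(1 / 2) * (mu0sq⁻¹ * (coeff221 P a K * (n * P.d))))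
          * Real.exp (-(1 / 2) * (msq⁻¹ * (coeff221 P a K * (n * N))))) := by
    rw [← Real.exp_add, ← Real.exp_add]
    congr 1
    ring
  rw [hexp, hpref]
  refine mul_le_mul_of_nonneg_left ?_ (Real.exp_pos _).le
  refine mul_le_mul (le_trans ?_ h1) (le_trans ?_ h2) (Real.exp_pos _).le (Real.rpow_pos_of_pos (det_one_add_mul_inv_pos hMv hRv) _).le
  · exact Real.exp_le_exp.2 (by linarith [t1])
  · exact Real.exp_le_exp.2 (by linarith [t2])

end Det

/-! ## §2 *"= exp(O(1)|T_ε|)"* with a constant depending on `ε₀` only -/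

section Uniform

variable (C : ChargeData N)

/-- `|T^{(K)}| = (L^Kε)^{−d}|T_ε|` for `K ≦` the `K` of (1.2) ((1.21): `|T^{(K)}|(L^Kε)^d = |T_ε|`, `B1Ineq368BoxBound.vol_univ_eq`). [cite: Balaban1982Higgs1, (1.21) p.607] -/
theorem card_site_eq_vol {K : ℕ} (hK : K ≤ P.K) :
    (Fintype.card (HiggsLattice.Site P K) : ℝ) = (P.mesh K ^ P.d)⁻¹ * P.vol 0 Finset.univ := by
  have h := vol_univ_eq (P := P) hK
  unfold HiggsLattice.Params.vol at h ⊢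
  rw [Finset.card_univ, Finset.card_univ] at h
  rw [Finset.card_univ, ← h, ← mul_assoc, inv_mul_cancel₀ (pow_pos (P.mesh_pos K) _).ne', one_mul]

/-- **`log q ≧ −(|log(a(1−L⁻²))| + |d−2|·log(L/ε₀) + log 2π)`** for `q = a_K(L^Kε)^{d−2}/2π` under the stopping rule with `ε₀ ≦ 1`: `a(1−L⁻²) < a_K`
((2.15)), `ε₀/L < L^Kε ≦ ε₀ ≦ 1` (p. 624). [cite: Balaban1982Higgs1, (2.15) p.609; p.624 (before (3.66)); (3.69) p.625] -/
theorem log_prec_ge {a : ℝ} (ha : 0 < a) (hL : 1 < (P.L : ℝ)) {K : ℕ} (hK1 : 1 ≤ K) {ε₀ : ℝ} (hε₀ : 0 < ε₀) (hε₀1 : ε₀ ≤ 1)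
    (hKε : P.mesh K ≤ ε₀) (hstop : ε₀ < P.mesh (K + 1)) :
    -(|Real.log (a * (1 - ((P.L : ℝ) ^ 2)⁻¹))| + |(P.d : ℝ) - 2| * Real.log ((P.L : ℝ) / ε₀) + Real.log (2 * Real.pi))
      ≤ Real.log (B1RT.prec (B1.aSeq a P.L K) (P.mesh K) P.d / (2 * Real.pi)) := by
  have hLpos : (0 : ℝ) < P.L := by linarith
  have hℓ : 0 < P.mesh K := P.mesh_pos K
  have hainf : 0 < a * (1 - ((P.L : ℝ) ^ 2)⁻¹) := by
    have : ((P.L : ℝ) ^ 2)⁻¹ < 1 := inv_lt_one_of_one_lt₀ (by nlinarith)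
    exact mul_pos ha (by linarith)
  have haK : a * (1 - ((P.L : ℝ) ^ 2)⁻¹) < B1.aSeq a P.L K := B1.ainf_lt_aSeq ha hL K hK1
  have haKpos : 0 < B1.aSeq a P.L K := hainf.trans haK
  have h2π : 0 < 2 * Real.pi := by positivity
  -- log q = log a_K + (d − 2) log ℓ − log 2π
  have hcast : (((P.d : ℤ) - 2 : ℤ) : ℝ) = (P.d : ℝ) - 2 := by
    rw [Int.cast_sub, Int.cast_natCast, Int.cast_ofNat]
  have hq : Real.log (B1RT.prec (B1.aSeq a P.L K) (P.mesh K) P.d / (2 * Real.pi))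
      = Real.log (B1.aSeq a P.L K) + ((P.d : ℝ) - 2) * Real.log (P.mesh K) - Real.log (2 * Real.pi) := by
    rw [B1RT.prec_eq, Real.log_div (mul_pos haKpos (zpow_pos hℓ _)).ne' h2π.ne', Real.log_mul haKpos.ne' (zpow_pos hℓ _).ne',
      Real.log_zpow, hcast]
  -- log a_K ≥ log(a(1 − L⁻²)) ≥ −|…|
  have h1 : -|Real.log (a * (1 - ((P.L : ℝ) ^ 2)⁻¹))| ≤ Real.log (B1.aSeq a P.L K) :=
    (neg_abs_le _).trans (Real.log_le_log hainf haK.le)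
  -- |log ℓ| ≤ log(L/ε₀): ε₀/L < ℓ ≤ ε₀ ≤ 1
  have hm := mesh_gt_of_stop (P := P) hstop
  have hlogℓ_le : Real.log (P.mesh K) ≤ 0 := Real.log_nonpos hℓ.le (hKε.trans hε₀1)
  have hlogℓ_ge : -Real.log ((P.L : ℝ) / ε₀) ≤ Real.log (P.mesh K) := by
    rw [← Real.log_inv, inv_div]
    exact Real.log_le_log (div_pos hε₀ hLpos) hm.le
  have hLε : 0 ≤ Real.log ((P.L : ℝ) / ε₀) := Real.log_nonneg ((one_le_div hε₀).2 (hε₀1.trans hL.le))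
  have h3 : -(|(P.d : ℝ) - 2| * Real.log ((P.L : ℝ) / ε₀)) ≤ ((P.d : ℝ) - 2) * Real.log (P.mesh K) := by
    rcases le_or_gt 0 ((P.d : ℝ) - 2) with hd | hd
    · rw [abs_of_nonneg hd]
      nlinarith [mul_nonneg hd (by linarith : 0 ≤ Real.log (P.mesh K) + Real.log ((P.L : ℝ) / ε₀))]
    · rw [abs_of_neg hd]
      nlinarith [mul_nonneg (by linarith : (0 : ℝ) ≤ 2 - P.d) (sub_nonneg.2 (hlogℓ_le.trans hLε))]
  rw [hq]
  linarith

/-- **The ε-INDEPENDENT constant `C₆` of (3.69) for the model**: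
`c6Unif d N L a μ₀² m² ε₀ = (L/ε₀)^d·[½(d+N)·(|log(a(1−L⁻²))| + |d−2|·log(L/ε₀) + log 2π) + ½a(L/ε₀)²(μ₀⁻²d + m⁻²N)]` — *"a constant O(1) which in general
depends on L^Kε, thus on ε₀"* (p. 625). [cite: Balaban1982Higgs1, (3.69) p.625] -/
noncomputable def c6Unif (d N L : ℕ) (a mu0sq msq ε₀ : ℝ) : ℝ :=
  ((L : ℝ) / ε₀) ^ d *
    (((d : ℝ) + N) / 2 * (|Real.log (a * (1 - ((L : ℝ) ^ 2)⁻¹))| + |(d : ℝ) - 2| * Real.log ((L : ℝ) / ε₀) + Real.log (2 * Real.pi))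
      + a / 2 * ((L : ℝ) / ε₀) ^ 2 * (mu0sq⁻¹ * d + msq⁻¹ * N))

/-- **(3.69) FOR THE MODEL WITH ITS ε-INDEPENDENT CONSTANT**: for `m², μ₀² > 0`, `a > 0`, `L > 1`, every `1 ≦ K ≦` the `K` of (1.2) obeying the stopping rule
`L^Kε ≦ ε₀ < L^{K+1}ε` with `ε₀ ≦ 1`: `exp(−c6Unif(d,N,L,a,μ₀²,m²,ε₀)·|T_ε|) ≦ Z_KZ_K(0)e^{−E₀}` — the print's *"= exp(O(1)|T_ε|)"*, i.e. the field `h369`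
of `B1LowerBound114Model.Inputs` for the model's own normalisations. [cite: Balaban1982Higgs1, (3.69) p.625; p.624 (before (3.66)); (2.15) p.609] -/
theorem ineq369_model_unif {msq mu0sq a : ℝ} (hmsq : 0 < msq) (hmu : 0 < mu0sq) (ha : 0 < a) (hL : 1 < (P.L : ℝ)) {K : ℕ}
    (hK1 : 1 ≤ K) (hK : K ≤ P.K) {ε₀ : ℝ} (hε₀ : 0 < ε₀) (hε₀1 : ε₀ ≤ 1) (hKε : P.mesh K ≤ ε₀) (hstop : ε₀ < P.mesh (K + 1)) :
    Real.exp (-(c6Unif P.d N P.L a mu0sq msq ε₀ * P.vol 0 Finset.univ))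
      ≤ zVec P mu0sq a K * zScal P C msq a K * Real.exp (-freeNormalization P 0 N C msq mu0sq) := by
  refine le_trans (Real.exp_le_exp.2 ?_) (ineq369_model C hmsq hmu ha hL hK1 hK)
  have hn := card_site_eq_vol (P := P) hK
  set n : ℝ := (Fintype.card (HiggsLattice.Site P K) : ℝ)
  have hvol : 0 ≤ P.vol 0 Finset.univ := volT_nonneg P
  have hLε : 0 ≤ Real.log ((P.L : ℝ) / ε₀) := Real.log_nonneg ((one_le_div hε₀).2 (hε₀1.trans hL.le))
  have hlogq := log_prec_ge (P := P) ha hL hK1 hε₀ hε₀1 hKε hstop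
  set Λ : ℝ := |Real.log (a * (1 - ((P.L : ℝ) ^ 2)⁻¹))| + |(P.d : ℝ) - 2| * Real.log ((P.L : ℝ) / ε₀) + Real.log (2 * Real.pi) with hΛ
  have hΛ0 : 0 ≤ Λ := by
    rw [hΛ]
    have h2π : 0 ≤ Real.log (2 * Real.pi) := Real.log_nonneg (by nlinarith [Real.pi_gt_three])
    have ha1 := abs_nonneg (Real.log (a * (1 - ((P.L : ℝ) ^ 2)⁻¹)))
    have hd2 := mul_nonneg (abs_nonneg ((P.d : ℝ) - 2)) hLε
    linarith
  -- the mesh factors: (L^Kε)^{−d} ≤ (L/ε₀)^d, a_K(L^Kε)^{−2} ≤ a(L/ε₀)²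
  have hinv2 := inv_mesh_sq_le_of_stop (P := P) hε₀ hstop
  have hinvd : (P.mesh K ^ P.d)⁻¹ ≤ ((P.L : ℝ) / ε₀) ^ P.d := by
    have hm := mesh_gt_of_stop (P := P) hstop
    have hLpos : (0 : ℝ) < P.L := by linarith
    rw [← inv_pow, ← inv_div]
    exact pow_le_pow_left₀ (inv_nonneg.2 (P.mesh_pos K).le) ((inv_le_inv₀ (P.mesh_pos K) (div_pos hε₀ hLpos)).2 hm.le) _
  have hcoef : coeff221 P a K ≤ a * ((P.L : ℝ) / ε₀) ^ 2 := by
    rw [coeff221_eq]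
    exact mul_le_mul (B1.aSeq_le ha hL K hK1) hinv2 (sq_nonneg _) ha.le
  have hn0 : 0 ≤ n := Nat.cast_nonneg _
  have hnle : n ≤ ((P.L : ℝ) / ε₀) ^ P.d * P.vol 0 Finset.univ := by
    rw [hn]
    exact mul_le_mul_of_nonneg_right hinvd hvol
  have hdN : (0 : ℝ) ≤ ((P.d : ℝ) + N) / 2 := by positivity
  have hmass : 0 ≤ mu0sq⁻¹ * (P.d : ℝ) + msq⁻¹ * N := by positivity
  -- first term: ½(d+N)·n·log q ≥ −½(d+N)·n·Λ ≥ −½(d+N)·Λ·(L/ε₀)^d·|T_ε|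
  have e1 : -(((P.d : ℝ) + N) / 2 * Λ * (((P.L : ℝ) / ε₀) ^ P.d * P.vol 0 Finset.univ))
      ≤ ((P.d : ℝ) + N) / 2 * n * Real.log (B1RT.prec (B1.aSeq a P.L K) (P.mesh K) P.d / (2 * Real.pi)) := by
    have h := mul_le_mul_of_nonneg_left hlogq (mul_nonneg hdN hn0)
    linarith [mul_le_mul_of_nonneg_left hnle (mul_nonneg hdN hΛ0)]
  -- second term: ½·coeff·(…)·n ≤ ½·a(L/ε₀)²·(…)·(L/ε₀)^d·|T_ε|
  have e2 : (1 / 2) * coeff221 P a K * (mu0sq⁻¹ * P.d + msq⁻¹ * N) * n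
      ≤ (1 / 2) * (a * ((P.L : ℝ) / ε₀) ^ 2) * (mu0sq⁻¹ * P.d + msq⁻¹ * N) * (((P.L : ℝ) / ε₀) ^ P.d * P.vol 0 Finset.univ) :=
    mul_le_mul (mul_le_mul_of_nonneg_right (mul_le_mul_of_nonneg_left hcoef (by norm_num)) hmass) hnle hn0 (by positivity)
  have hc6 : c6Unif P.d N P.L a mu0sq msq ε₀
      = ((P.L : ℝ) / ε₀) ^ P.d * (((P.d : ℝ) + N) / 2 * Λ + a / 2 * ((P.L : ℝ) / ε₀) ^ 2 * (mu0sq⁻¹ * P.d + msq⁻¹ * N)) := by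
    unfold c6Unif
    rw [hΛ]
  rw [hc6]
  linarith [e1, e2]

end Uniform

/-! ## §3 The model's ledger of (1.14) with `Z_K, Z_K(0), E₀` concrete and `h369` discharged -/

section Ledger

/-- **The displayed inputs of Sects. 2–3 on ONE lattice with the normalisations AND the quadratic forms of (3.66) being the model's own**:
`B1Ineq368QuadForms.PreInputs` without `ZK, ZK0, E₀, hZK, hZK0, h369` — a stopping scale `1 ≦ K ≦` the `K` of (1.2) with `L^Kε ≦ ε₀ < L^{K+1}ε`, thresholds,
effective actions `S^{(k)}` (`S^{(0)} = S^ε`, `exp(−S^{(k)}) ∈ L¹`), the (3.26) step bound `h360`, the interaction `V^{(K),ε}` with (E1) the expansion (3.66)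
of Prop. 3.1 on the support of `χ_K` FOR `Z_K = zVec`, `Z_K(0) = zScal`, `E₀ = ModelData.e0`, `½⟨A,Δ^{(K)}A⟩ = ½qVec`, `½⟨φ,Δ^{(K)}(0)φ⟩ = ½qScal`, (E2)
`|V^{(K),ε}| ≦ C₂|T_ε|`, (E3) `χ_K = 1` on `S_{r₀}`. [cite: Balaban1982Higgs1, (3.66) p.624; (3.26) p.617; (3.67)–(3.69) p.625] -/
structure PreInputs369 (D : ModelData) (U : B1LowerBound114Model.Consts) (P : HiggsLattice.Params) where
  K : ℕ
  hK1 : 1 ≤ K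
  hKP : K ≤ P.K
  hKε : P.mesh K ≤ U.ε₀
  hstop : U.ε₀ < P.mesh (K + 1)
  ℓ : ℕ → ℝ
  p : ℕ → ℝ
  S : (k : ℕ) → HiggsLattice.VecField P k → HiggsLattice.ScalarField P k D.N → ℝ
  h0 : S 0 = action D.C (couplings D P)
  hS : ∀ k, k ≤ K → Integrable fun Φ : HiggsLattice.VecField P k × HiggsLattice.ScalarField P k D.N => Real.exp (-S k Φ.1 Φ.2)
  h360 : ∀ k, k < K → ∀ (B : HiggsLattice.VecField P (k + 1)) (ψ : HiggsLattice.ScalarField P (k + 1) D.N),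
    chiW D.C ℓ p D.mu0sq D.msq U.a (k + 1) B ψ ≠ 0 →
      Real.exp (-S (k + 1) B ψ) * Real.exp (-(U.Cst * P.mesh k ^ U.κ₀ * P.vol 0 Finset.univ))
        ≤ doubleRTk D.C U.a (extW D.mu0sq U.a k) (fun A φ => chiW D.C ℓ p D.mu0sq D.msq U.a k A φ * Real.exp (-S k A φ)) B ψ
  V : HiggsLattice.VecField P K × HiggsLattice.ScalarField P K D.N → ℝ
  hE1 : ∀ ω : HiggsLattice.VecField P K × HiggsLattice.ScalarField P K D.N, chiW D.C ℓ p D.mu0sq D.msq U.a K ω.1 ω.2 ≠ 0 →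
    zVec P D.mu0sq U.a K * zScal P D.C D.msq U.a K
        * Real.exp (-(qVec P D.mu0sq U.a K ω.1) / 2 - qScal D.C D.msq U.a K ω.2 / 2 + V ω - D.e0 P - U.C₁ * P.vol 0 Finset.univ)
      ≤ Real.exp (-S K ω.1 ω.2)
  hE2 : ∀ ω : HiggsLattice.VecField P K × HiggsLattice.ScalarField P K D.N, chiW D.C ℓ p D.mu0sq D.msq U.a K ω.1 ω.2 ≠ 0 →
    |V ω| ≤ U.C₂ * P.vol 0 Finset.univ
  hE3 : ∀ ω ∈ smallSet P D.N K U.r₀, chiW D.C ℓ p D.mu0sq D.msq U.a K ω.1 ω.2 = 1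

/-- **`h369` DISCHARGED**: on a lattice with the model's `d, L`, the pre-inputs give this seat's `PreInputs` (gen 11) with `Z_K := zVec`, `Z_K(0) := zScal`,
`E₀ := ModelData.e0` and the (3.69) conjunct PROVED (`ineq369_model_unif`), provided `C₆ ≧ c6Unif(d,N,L,a,μ₀²,m²,ε₀)` and `ε₀ ≦ 1` (`m², μ₀² > 0`, `L > 1`).
[cite: Balaban1982Higgs1, (3.69) p.625; Theorem (1.14) p.606] -/
noncomputable def PreInputs369.toPreInputs {D : ModelData} {U : B1LowerBound114Model.Consts} {P : HiggsLattice.Params} (X : PreInputs369 D U P)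
    (hm : 0 < D.msq) (hmu : 0 < D.mu0sq) (hPd : P.d = D.d) (hPL : P.L = D.L) (hL : 1 < D.L) (hε₀1 : U.ε₀ ≤ 1)
    (hC6 : c6Unif D.d D.N D.L U.a D.mu0sq D.msq U.ε₀ ≤ U.C₆) : PreInputs D U P :=
  { K := X.K, hKP := X.hKP, hKε := X.hKε, hstop := X.hstop, ℓ := X.ℓ, p := X.p, S := X.S, h0 := X.h0, hS := X.hS, h360 := X.h360, V := X.V,
    ZK := zVec P D.mu0sq U.a X.K, ZK0 := zScal P D.C D.msq U.a X.K, E₀ := D.e0 P,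
    hZK := (zVec_pos hmu U.ha (by rw [hPL]; exact_mod_cast hL) X.hK1).le,
    hZK0 := (zScal_pos D.C hm U.ha (by rw [hPL]; exact_mod_cast hL) X.hK1).le,
    hE1 := X.hE1, hE2 := X.hE2, hE3 := X.hE3,
    h369 := by
      have hL' : 1 < (P.L : ℝ) := by
        rw [hPL]
        exact_mod_cast hL
      have h := ineq369_model_unif D.C hm hmu U.ha hL' X.hK1 X.hKP U.hε₀ hε₀1 X.hKε X.hstop
      rw [hPd, hPL] at h
      have e : -U.C₆ * P.vol 0 Finset.univ ≤ -(c6Unif D.d D.N D.L U.a D.mu0sq D.msq U.ε₀ * P.vol 0 Finset.univ) := by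
        rw [neg_mul]
        exact neg_le_neg (mul_le_mul_of_nonneg_right hC6 (volT_nonneg P))
      exact (Real.exp_le_exp.2 e).trans h }

/-- … and hence the FULL `B1LowerBound114Model.Inputs` (this seat's `PreInputs.toInputs`, gen 11: the forms' `hQ` discharged given `C₅ ≧ c5Unif`).
[cite: Balaban1982Higgs1, Theorem (1.14) p.606; (3.68)–(3.69) p.625] -/
noncomputable def PreInputs369.toInputs {D : ModelData} {U : B1LowerBound114Model.Consts} {P : HiggsLattice.Params} (X : PreInputs369 D U P)
    (hm : 0 < D.msq) (hmu : 0 < D.mu0sq) (hPd : P.d = D.d) (hPL : P.L = D.L) (hL : 1 < D.L) (hε₀1 : U.ε₀ ≤ 1)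
    (hC5 : c5Unif D.d D.L U.a D.mu0sq D.msq U.ε₀ U.r₀ ≤ U.C₅) (hC6 : c6Unif D.d D.N D.L U.a D.mu0sq D.msq U.ε₀ ≤ U.C₆) :
    B1LowerBound114Model.Inputs D U P :=
  (X.toPreInputs hm hmu hPd hPL hL hε₀1 hC6).toInputs hm hmu hPd hPL hL hC5

/-- **Per lattice**: the pre-inputs on an admissible lattice give `exp(−E₋|T_ε|) ≦ Z^ε` with the ε-independent `E₋ = U.eMinus D =
C₁ + C₂ + C·ε₀^{κ₀}/(L^{κ₀} − 1) + C₄(ε₀/L, r₀) + C₅ + C₆`. [cite: Balaban1982Higgs1, Theorem (1.14) p.606; (3.68)–(3.69) p.625] -/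
theorem lowerBound_lattice_of_preInputs369 (D : ModelData) (hm : 0 < D.msq) (hmu : 0 < D.mu0sq) (hL : 1 < D.L)
    (U : B1LowerBound114Model.Consts) (hε₀1 : U.ε₀ ≤ 1) (hC5 : c5Unif D.d D.L U.a D.mu0sq D.msq U.ε₀ U.r₀ ≤ U.C₅)
    (hC6 : c6Unif D.d D.N D.L U.a D.mu0sq D.msq U.ε₀ ≤ U.C₆) {P : HiggsLattice.Params} (hP : D.Admissible P) (X : PreInputs369 D U P) :
    Real.exp (-(U.eMinus D * volT P)) ≤ D.zRen P :=
  lowerBound_lattice D hm hL U hP (X.toInputs hm hmu hP.1 hP.2.1 hL hε₀1 hC5 hC6)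

/-- A lattice ADMITS A STOPPING SCALE (within the range of (1.2)) at the unit scale `ε₀`: some `1 ≦ K ≦ K_{(1.2)}` with `L^Kε ≦ ε₀ < L^{K+1}ε` — p. 624
*"We take K such that L^Kε ≦ ε₀, but L^{K+1}ε > ε₀"* (such a `K ≧ 1` exists iff `Lε ≦ ε₀` and then is unique, `B1StoppingScale366`).
[cite: Balaban1982Higgs1, p.624 (before (3.66)); (1.2) p.604] -/
def HasStop (P : HiggsLattice.Params) (ε₀ : ℝ) : Prop :=
  ∃ K : ℕ, 1 ≤ K ∧ K ≤ P.K ∧ P.mesh K ≤ ε₀ ∧ ε₀ < P.mesh (K + 1)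

/-- **The sub-family of r01's concrete cutoff family on which the print's stopping rule operates**: the admissible lattices of the model that admit
a stopping scale at `ε₀` (same `eps`, `vol = |T_ε|`, `Z = Z^ε` as `ModelData.cutoffFamily`). [cite: Balaban1982Higgs1, Theorem (1.14) p.606; p.624 (before (3.66))] -/
noncomputable def cutoffFamilyStop (D : ModelData) (ε₀ : ℝ) : B1LowerBound.CutoffFamily {P : HiggsLattice.Params // D.Admissible P ∧ HasStop P ε₀} where
  eps P := P.1.ε
  vol P := volT P.1
  Z P := D.zRen P.1

/-- **Theorem (1.14), lower half, FOR THE MODEL on the lattices with a stopping scale, from the pre-inputs**: if every admissible lattice admitting a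
stopping scale carries the pre-inputs of Sects. 2–3 (normalisations and forms the model's own; constants `U` chosen before the lattice with
`C₅ ≧ c5Unif`, `C₆ ≧ c6Unif`, `ε₀ ≦ 1`), then `exp(−E₋|T_ε|) ≦ Z^ε` on that whole sub-family with ONE constant `E₋ = U.eMinus D`.
[cite: Balaban1982Higgs1, Theorem (1.14) p.606; (3.68)–(3.69) p.625] -/
theorem lowerBoundWith_cutoffFamilyStop (D : ModelData) (hm : 0 < D.msq) (hmu : 0 < D.mu0sq) (hL : 1 < D.L) (U : B1LowerBound114Model.Consts)
    (hε₀1 : U.ε₀ ≤ 1) (hC5 : c5Unif D.d D.L U.a D.mu0sq D.msq U.ε₀ U.r₀ ≤ U.C₅) (hC6 : c6Unif D.d D.N D.L U.a D.mu0sq D.msq U.ε₀ ≤ U.C₆)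
    (h : ∀ P : HiggsLattice.Params, D.Admissible P → HasStop P U.ε₀ → Nonempty (PreInputs369 D U P)) :
    B1LowerBound.LowerBoundWith (cutoffFamilyStop D U.ε₀) (U.eMinus D) := by
  intro i
  obtain ⟨X⟩ := h i.1 i.2.1 i.2.2
  exact lowerBound_lattice_of_preInputs369 D hm hmu hL U hε₀1 hC5 hC6 i.2.1 X

/-- *"there exist the constant E₋ independent of ε, T_ε"* with `exp(−E₋|T_ε|) ≦ Z^ε` on the sub-family — r14's `B1LowerBound.LowerBoundPrinted`.
[cite: Balaban1982Higgs1, Theorem (1.14) p.606] -/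
theorem lowerBoundPrinted_cutoffFamilyStop (D : ModelData) (hm : 0 < D.msq) (hmu : 0 < D.mu0sq) (hL : 1 < D.L) (U : B1LowerBound114Model.Consts)
    (hε₀1 : U.ε₀ ≤ 1) (hC5 : c5Unif D.d D.L U.a D.mu0sq D.msq U.ε₀ U.r₀ ≤ U.C₅) (hC6 : c6Unif D.d D.N D.L U.a D.mu0sq D.msq U.ε₀ ≤ U.C₆)
    (h : ∀ P : HiggsLattice.Params, D.Admissible P → HasStop P U.ε₀ → Nonempty (PreInputs369 D U P)) :
    B1LowerBound.LowerBoundPrinted (cutoffFamilyStop D U.ε₀) :=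
  ⟨U.eMinus D, lowerBoundWith_cutoffFamilyStop D hm hmu hL U hε₀1 hC5 hC6 h⟩

end Ledger

end Literature.MathematicalPhysics.QuantumFieldTheory.Balaban1983to89.B1Eq369Model
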